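import Literature.MathematicalPhysics.QuantumFieldTheory.Balaban1983to89.Node00.MultiScaleFibreChart
import Literature.MathematicalPhysics.QuantumFieldTheory.Balaban1983to89.BlockAveragingEMLLinearisedBackground

/-!
# NODE 00 — THE LINEARISED `k`-FOLD AVERAGING `Q_k(U₀)` AT A BACKGROUND, AS ONE NAMED CONTINUOUS LINEAR OPERATOR: the Fréchet derivative of 35b's matrix
# extension `iterM k` of `U ↦ Ū^k` at `↑U₀`, its Leibniz∕chain structure, the chain rule along the levels, the velocity of `Ū^k` along 35a's exponential chart,
# and print's left-trivialised `𝔰𝔲(N)` reading (module D4 of the [15] Sect. B audit of seat `pub-ymgap-dag-n07-w1`)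

Cell `pub-ymgap`, width seat `pub-ymgap-dag-n07-w1` generation 0 (DAG node N07 = [15] = [Balaban1985Variational]; item (α) of the lane owner dag-n07-e's word, INBOX l.26171;
INTENT-5 l.26821).  NEW leaf, `--kind definition --supports stmt-QuantumFields-20542` (K1⁷), count-neutral.  CONSUMED BY NAME, nothing modified: 35b `Node00.AveragingSmooth`
(`coeField`, `stepM`, `holM`, `loopM`, `axialM`, `corrM`, `avgM`, `iterM`, `SmallBelow`, `contDiffAt_avgM`, `contDiffAt_iterM`, `coeField_iter_eq_iterM`), 35a
`Node00.CriticalOnFibreTangent` (`expChart`, `hasDerivAt_coe_expChart_along`, `hasDerivAt_ray`), n07-w2's `Node00.MultiScaleFibreChart` (`eventually_smallBelow_expChart`: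
the guard is open along the chart), `ExpMeanLog.analyticAt_eml`, `BlockAveraging` (the (0.4) walks).

THE PRINT.  [Balaban1985Variational] (44) p. 285: *«Q_k(U₀) is the linearisation of the k-fold averaging operation at the configuration U₀»* (the operator of the
linear constraint in the variational problem (43)–(48) and of the quadratic form (27)); [Balaban1985BackgroundPropagators] (3.13)–(3.16) p. 393 (the same operator in the
background-field propagators); [Balaban1985Averaging] Prop. 3 (121)–(125) p. 36 (*«Q(V₀, A, c) is an analytic function of A and … its Taylor expansion begins with a
first-order polynomial … L(Q(V₀)A)_c»*); [Balaban1987RG1] (0.4) p. 253, (0.21) p. 256 (the averaging of record and its `k`-fold iterate).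

WHAT THIS FILE WRITES (`M = M_N(ℂ)`, fine fields `V, Y : bonds → M`; every `def` has a body; the operator is TOTAL — `fderiv` junk off the differentiability locus —
and every differentiability∕agreement statement carries 35b's guard `SmallBelow` or the polydisc hypothesis explicitly).
* §1 `dStepL s` (the derivative of `V ↦ stepM V s`: the real-linear map `Y ↦ stepM Y s` itself), `dHolL V₀ γ` (the derivative of the walk product `V ↦ holM V γ` at `V₀`,
  Leibniz recursion `dHolL V₀ (s∷γ) = stepM V₀ s • dHolL V₀ γ + (dStepL s)·holM V₀ γ`), ★ `hasFDerivAt_holM` (at EVERY field).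
* §2 `dAvgL V₀ := fderiv ℝ avgM V₀` (one level), ★ `hasFDerivAt_avgM` (in the polydisc `‖loopM V₀ c i − 1‖ < 1`), `hasFDerivAt_avgM_apply_of_eml` + ★ `dAvgL_apply` (THE FORMULA:
  `(dAvgL V₀ Y)(c) = D eml(W⁰_c)[(dHolL V₀ loop_i Y)_i]·axialM V₀ c + corrM V₀ c·dHolL V₀ [c₋,c₊] Y`, `W⁰_c` the background loop matrices).
* §3 ★★ `dIterL k V₀ := fderiv ℝ (iterM k) V₀ : (PBond P 0 → M) →L[ℝ] (PBond P k → M)` — PRINT'S `Q_k(U₀)` ON MATRIX-VALUED FINE FIELDS at `V₀ = ↑U₀`; `dIterL_zero`,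
  `hasFDerivAt_iterM_succ_of` ∕ `dIterL_succ_of` (chain rule given differentiability), ★ `hasFDerivAt_iterM` (under `SmallBelow … k U`), `loopM_iterM_mem_polydisc`, ★ `dIterL_succ`
  (`Q_{k+1}(U₀) = dAvgL(↑Ū^k(U₀)) ∘ Q_k(U₀)` under the guard below `k+1`), ★ `hasDerivAt_coeField_iter_of_eventually` (curve form: a family `Γ` with matrix velocity `Y` at `0`
  and the guard eventually along it ⇒ `d∕dt ↑Ū^k(Γ t)|₀ = Q_k(↑Γ 0) Y` for the TRUE averaging), ★★ `hasDerivAt_coeField_iter_expChart_smul` ∕ `hasDerivAt_coe_iter_expChart_smul`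
  (along 35a's chart: `d∕dt ↑Ū^k(U·exp(tX))(c)|₀ = (Q_k(↑U)[b ↦ U_b X_b])(c)` under `SmallBelow … k U` — the velocity 35c∕35e and n07-w2's chart derivative are phrased in).
* §4 `qLin k U₀ X c := (iterM k ↑U₀ c)⋆ · (Q_k(↑U₀)[b ↦ U₀,b X_b])(c)` — print's `Q_k(U₀)X` in the LEFT-TRIVIALISED reading of 35a∕35e (velocity of `t ↦ Ū^k(U₀·exp(tX))(c)` pulled
  back to the identity), TOTAL and `M`-valued; `qLin_add ∕ _smul ∕ _zero` (LINEARITY), `coe_iter_mul_qLin` (read back: `↑Ū^k(U₀)(c) · qLin = velocity` under the guard),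
  ★ `qLin_eq_zero_iff` (KERNEL currency: `qLin k U₀ X c = 0 ↔` the chart velocity at `c` vanishes), ★★ `qLin_eq_zero_iff_hasDerivAt_zero` (`qLin k U₀ X = 0 ↔` the
  `HasDerivAt … 0 0` kernel hypothesis of 35c∕35e at every level-`k` bond).
* §5 at NODE 00's objects (`avOfRecord F N K j = blockAvg expMeanLogSU`, `rfl`): `hasFDerivAt_iterM_avOfRecord`, `dIterL_succ_avOfRecord`, `hasDerivAt_coeField_avgFamily_of_eventually`.

NOT HERE (sequel files): the FLAT background (`U₀ = 1`: `dAvgL 1 = linAvg` on skew fields and `Q_k(1)` = the `linAvg` recursion — the S2 (47) ∕ S4 (157) junction), the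
`𝔰𝔲(N)`-membership of `qLin` and KERNEL = fibre tangent (Summits-side, via 35c∕35e BY NAME), COVARIANCE under gauge transformations, LOCALITY (the (0.4) window).
`BlockAveragingEMLLinearisedBackground.covLinAvg` is print's main term of (124) up to `O(α|Y|)` in estimate form and is NOT asserted equal to `dAvgL ↑U₀` (different object).

HONEST FRAMING: real calculus∕bookkeeping about the tree's own averaging map (35b's matrix extension); definitions with bodies and kernel-checked lemmas; NO estimate of
[15]∕[5]∕[7]; N07 NOT discharged; counts unmoved (5∕27); one finite 𝕋⁴ programme at fixed ε — NOT continuum ∕ ℝ⁴ ∕ OS ∕ mass gap ∕ Clay (R4 closes the conditional finite-𝕋⁴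
rung `BalabanLadder.UV` only).  No `sorry`, no `instance`, no `notation`.
-/

noncomputable section

namespace Literature.MathematicalPhysics.QuantumFieldTheory.Balaban1983to89.Node00

open Filter Topology
open T4Continuum BlockAveraging B15DeterminingSets
open ExpMeanLog (eml eml_eq_exp expMeanLogSU deltaSU analyticAt_eml lt_third_of_lt_deltaSU)
open T4AdjointCovarianceUnitary (lieSU expSU coe_expSU)
open scoped Matrix.Norms.L2Operator

/-! ## §1  Derivatives of the step matrices and of the walk products -/

section Walks

variable {P : Params} {j : ℕ} {N : ℕ}

/-- **The derivative of one step matrix** `V ↦ stepM V s` (evaluation at `b(s)`, followed by the real-linear adjoint on a backward step): the continuous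
real-linear map `Y ↦ stepM Y s` itself. [cite: Balaban1987RG1, (0.4) p.253 (bookkeeping)] -/
def dStepL (s : LStep P j) : (PBond P j → Matrix (Fin N) (Fin N) ℂ) →L[ℝ] Matrix (Fin N) (Fin N) ℂ :=
  if s.fwd then ContinuousLinearMap.proj (R := ℝ) (φ := fun _ : PBond P j => Matrix (Fin N) (Fin N) ℂ) s.bond
  else ((starL' ℝ : Matrix (Fin N) (Fin N) ℂ ≃L[ℝ] Matrix (Fin N) (Fin N) ℂ) : Matrix (Fin N) (Fin N) ℂ →L[ℝ] Matrix (Fin N) (Fin N) ℂ).comp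
    (ContinuousLinearMap.proj (R := ℝ) (φ := fun _ : PBond P j => Matrix (Fin N) (Fin N) ℂ) s.bond)

/-- `dStepL s Y = stepM Y s`. [cite: Balaban1987RG1, (0.4) p.253 (bookkeeping)] -/
@[simp] theorem dStepL_apply (s : LStep P j) (Y : PBond P j → Matrix (Fin N) (Fin N) ℂ) : dStepL s Y = stepM Y s := by
  unfold dStepL stepM
  by_cases h : s.fwd
  · simp only [h, if_true]; rfl
  · simp only [h]; rfl

/-- `V ↦ stepM V s` has derivative `dStepL s` everywhere (it IS that linear map). [cite: Balaban1987RG1, (0.4) p.253 (bookkeeping)] -/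
theorem hasFDerivAt_stepM (V₀ : PBond P j → Matrix (Fin N) (Fin N) ℂ) (s : LStep P j) :
    HasFDerivAt (fun V : PBond P j → Matrix (Fin N) (Fin N) ℂ => stepM V s) (dStepL s) V₀ := by
  have h : (fun V : PBond P j → Matrix (Fin N) (Fin N) ℂ => stepM V s) = dStepL (N := N) s := funext fun V => (dStepL_apply s V).symm
  rw [h]
  exact (dStepL s).hasFDerivAt

/-- ★ **The derivative of the walk product** `V ↦ holM V γ = ∏_{s∈γ} stepM V s` at `V₀`, by the Leibniz recursion along the walk:
`dHolL V₀ [] = 0`, `dHolL V₀ (s∷γ) = stepM V₀ s • dHolL V₀ γ + (dStepL s)(·)·holM V₀ γ`. [cite: Balaban1985Averaging, (58) p.27; Balaban1987RG1, (0.4) p.253] -/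
def dHolL (V₀ : PBond P j → Matrix (Fin N) (Fin N) ℂ) : List (LStep P j) → ((PBond P j → Matrix (Fin N) (Fin N) ℂ) →L[ℝ] Matrix (Fin N) (Fin N) ℂ)
  | [] => 0
  | s :: γ => stepM V₀ s • dHolL V₀ γ + (dStepL s).smulRight (holM V₀ γ)

/-- No steps: zero derivative. [cite: Balaban1985Averaging, (58) p.27 (bookkeeping)] -/
@[simp] theorem dHolL_nil (V₀ : PBond P j → Matrix (Fin N) (Fin N) ℂ) : dHolL V₀ [] = 0 := rfl

/-- The Leibniz recursion, as continuous linear maps. [cite: Balaban1985Averaging, (58) p.27 (bookkeeping)] -/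
theorem dHolL_cons (V₀ : PBond P j → Matrix (Fin N) (Fin N) ℂ) (s : LStep P j) (γ : List (LStep P j)) :
    dHolL V₀ (s :: γ) = stepM V₀ s • dHolL V₀ γ + (dStepL s).smulRight (holM V₀ γ) := rfl

/-- The Leibniz recursion, applied: `dHolL V₀ (s∷γ) Y = stepM V₀ s·dHolL V₀ γ Y + stepM Y s·holM V₀ γ`. [cite: Balaban1985Averaging, (58) p.27 (bookkeeping)] -/
theorem dHolL_cons_apply (V₀ : PBond P j → Matrix (Fin N) (Fin N) ℂ) (s : LStep P j) (γ : List (LStep P j)) (Y : PBond P j → Matrix (Fin N) (Fin N) ℂ) :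
    dHolL V₀ (s :: γ) Y = stepM V₀ s * dHolL V₀ γ Y + stepM Y s * holM V₀ γ := by
  rw [dHolL_cons, add_apply, smul_apply, ContinuousLinearMap.smulRight_apply, dStepL_apply, smul_eq_mul, smul_eq_mul]

/-- ★ **WALK PRODUCTS ARE DIFFERENTIABLE AT EVERY FIELD WITH DERIVATIVE `dHolL`** (induction on the walk, product rule in the Banach algebra `M_N(ℂ)`).
[cite: Balaban1985Averaging, (58) p.27; Balaban1987RG1, (0.4) p.253 («analytic function»)] -/
theorem hasFDerivAt_holM (V₀ : PBond P j → Matrix (Fin N) (Fin N) ℂ) :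
    ∀ γ : List (LStep P j), HasFDerivAt (fun V : PBond P j → Matrix (Fin N) (Fin N) ℂ => holM V γ) (dHolL V₀ γ) V₀
  | [] => by
    simp only [holM_nil, dHolL_nil]
    exact hasFDerivAt_const _ _
  | s :: γ => by
    simp only [holM_cons]
    exact (hasFDerivAt_stepM V₀ s).mul' (hasFDerivAt_holM V₀ γ)

end Walks

/-! ## §2  The linearised one-step averaging `dAvgL V₀` and its Leibniz∕chain structure -/

section OneStep

variable {P : Params} {j : ℕ} {N : ℕ}

/-- **The linearised ONE-STEP averaging at the field `V₀`**: the Fréchet derivative of 35b's matrix extension `avgM` (total; meaningful in the polydisc).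
[cite: Balaban1985Averaging, (121)-(124) p.36; Balaban1987RG1, (0.4) p.253] -/
def dAvgL (V₀ : PBond P j → Matrix (Fin N) (Fin N) ℂ) :
    (PBond P j → Matrix (Fin N) (Fin N) ℂ) →L[ℝ] (PBond P (j + 1) → Matrix (Fin N) (Fin N) ℂ) :=
  fderiv ℝ (avgM : (PBond P j → Matrix (Fin N) (Fin N) ℂ) → PBond P (j + 1) → Matrix (Fin N) (Fin N) ℂ) V₀

/-- ★ In the polydisc `‖loopM V₀ c i − 1‖ < 1` (every coarse bond, every loop) `avgM` has derivative `dAvgL V₀` (35b `contDiffAt_avgM`). [cite: Balaban1985Averaging, Prop. 3 (121)-(122) p.36] -/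
theorem hasFDerivAt_avgM {V₀ : PBond P j → Matrix (Fin N) (Fin N) ℂ} (h : ∀ (c : PBond P (j + 1)) (i : Idx P), ‖loopM V₀ c i - 1‖ < 1) :
    HasFDerivAt (avgM : (PBond P j → Matrix (Fin N) (Fin N) ℂ) → PBond P (j + 1) → Matrix (Fin N) (Fin N) ℂ) (dAvgL V₀) V₀ :=
  ((contDiffAt_avgM h).differentiableAt (by simp)).hasFDerivAt

/-- The tuple of (0.4) loop matrices at `c` has derivative the tuple of walk-product derivatives. [cite: Balaban1987RG1, (0.4) p.253 (bookkeeping)] -/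
theorem hasFDerivAt_loopM_pi (V₀ : PBond P j → Matrix (Fin N) (Fin N) ℂ) (c : PBond P (j + 1)) :
    HasFDerivAt (fun (V : PBond P j → Matrix (Fin N) (Fin N) ℂ) (i : Idx P) => loopM V c i)
      (ContinuousLinearMap.pi fun i : Idx P => dHolL V₀ (walk (emb c.src) (loopWord P.L c.dir (off i.1) i.2.1 i.2.2))) V₀ :=
  hasFDerivAt_pi.2 fun _ => hasFDerivAt_holM V₀ _

/-- **LEIBNIZ∕CHAIN STRUCTURE OF THE ONE-STEP DERIVATIVE AT A BOND**, given a derivative `E` of `exp[mean log]` at the background loop matrices `W⁰_c`: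
`D(avgM · c)(V₀) = corrM V₀ c • dHolL V₀ [c₋,c₊] + (E ∘ (dHolL V₀ loop_i)_i)(·)·axialM V₀ c`. [cite: Balaban1985Averaging, (124) p.36; Balaban1987RG1, (0.4) p.253] -/
theorem hasFDerivAt_avgM_apply_of_eml {V₀ : PBond P j → Matrix (Fin N) (Fin N) ℂ} (c : PBond P (j + 1))
    {E : (Idx P → Matrix (Fin N) (Fin N) ℂ) →L[ℝ] Matrix (Fin N) (Fin N) ℂ}
    (hE : HasFDerivAt (eml : (Idx P → Matrix (Fin N) (Fin N) ℂ) → Matrix (Fin N) (Fin N) ℂ) E (fun i => loopM V₀ c i)) :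
    HasFDerivAt (fun V : PBond P j → Matrix (Fin N) (Fin N) ℂ => avgM V c)
      (corrM V₀ c • dHolL V₀ (walk (emb c.src) (List.replicate P.L (c.dir, true))) +
        (E.comp (ContinuousLinearMap.pi fun i : Idx P => dHolL V₀ (walk (emb c.src) (loopWord P.L c.dir (off i.1) i.2.1 i.2.2)))).smulRight
          (axialM V₀ c)) V₀ := by
  have hcorr : HasFDerivAt (fun V : PBond P j → Matrix (Fin N) (Fin N) ℂ => corrM V c)
      (E.comp (ContinuousLinearMap.pi fun i : Idx P => dHolL V₀ (walk (emb c.src) (loopWord P.L c.dir (off i.1) i.2.1 i.2.2)))) V₀ :=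
    hE.comp V₀ (hasFDerivAt_loopM_pi V₀ c)
  have hax : HasFDerivAt (fun V : PBond P j → Matrix (Fin N) (Fin N) ℂ => axialM V c)
      (dHolL V₀ (walk (emb c.src) (List.replicate P.L (c.dir, true)))) V₀ := hasFDerivAt_holM V₀ _
  exact hcorr.mul' hax

/-- In the polydisc the unguarded `exp[mean log]` has real derivative its complex Fréchet derivative (`ExpMeanLog.analyticAt_eml`). [cite: Balaban1987RG1, p.253 («analytic function»)] -/
theorem hasFDerivAt_eml_loopM {V₀ : PBond P j → Matrix (Fin N) (Fin N) ℂ} (c : PBond P (j + 1)) (h : ∀ i : Idx P, ‖loopM V₀ c i - 1‖ < 1) :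
    HasFDerivAt (eml : (Idx P → Matrix (Fin N) (Fin N) ℂ) → Matrix (Fin N) (Fin N) ℂ)
      ((fderiv ℂ (eml : (Idx P → Matrix (Fin N) (Fin N) ℂ) → Matrix (Fin N) (Fin N) ℂ) (fun i => loopM V₀ c i)).restrictScalars ℝ)
      (fun i => loopM V₀ c i) :=
  ((analyticAt_eml (𝔸 := Matrix (Fin N) (Fin N) ℂ) h).differentiableAt.hasFDerivAt).restrictScalars ℝ

/-- ★ **THE ONE-STEP FORMULA**: in the polydisc, `(dAvgL V₀ Y)(c) = D eml(W⁰_c)[(dHolL V₀ loop_i Y)_i]·axialM V₀ c + corrM V₀ c·dHolL V₀ [c₋,c₊] Y`.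
[cite: Balaban1985Averaging, (124) p.36; Balaban1987RG1, (0.4) p.253] -/
theorem dAvgL_apply {V₀ : PBond P j → Matrix (Fin N) (Fin N) ℂ} (h : ∀ (c : PBond P (j + 1)) (i : Idx P), ‖loopM V₀ c i - 1‖ < 1)
    (Y : PBond P j → Matrix (Fin N) (Fin N) ℂ) (c : PBond P (j + 1)) :
    dAvgL V₀ Y c =
      (fderiv ℂ (eml : (Idx P → Matrix (Fin N) (Fin N) ℂ) → Matrix (Fin N) (Fin N) ℂ) (fun i => loopM V₀ c i))
          (fun i => dHolL V₀ (walk (emb c.src) (loopWord P.L c.dir (off i.1) i.2.1 i.2.2)) Y) * axialM V₀ c +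
        corrM V₀ c * dHolL V₀ (walk (emb c.src) (List.replicate P.L (c.dir, true))) Y := by
  have h1 : HasFDerivAt (fun V : PBond P j → Matrix (Fin N) (Fin N) ℂ => avgM V c)
      ((ContinuousLinearMap.proj (R := ℝ) (φ := fun _ : PBond P (j + 1) => Matrix (Fin N) (Fin N) ℂ) c).comp (dAvgL V₀)) V₀ :=
    (hasFDerivAt_pi'.1 (hasFDerivAt_avgM h)) c
  have h2 := hasFDerivAt_avgM_apply_of_eml c (hasFDerivAt_eml_loopM c (h c))
  have h12 := h1.unique h2
  have happ := congrArg (fun L : (PBond P j → Matrix (Fin N) (Fin N) ℂ) →L[ℝ] Matrix (Fin N) (Fin N) ℂ => L Y) h12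
  simp only [ContinuousLinearMap.comp_apply, ContinuousLinearMap.proj_apply, add_apply, smul_apply, ContinuousLinearMap.smulRight_apply,
    ContinuousLinearMap.coe_restrictScalars', smul_eq_mul] at happ
  rw [happ, add_comm]
  rfl

end OneStep

/-! ## §3  THE OPERATOR `Q_k(U₀) = dIterL k ↑U₀`: chain rule along the levels, the guard, curve and chart forms -/

section Iterate

variable {P : Params} {N : ℕ}

/-- ★★ **PRINT'S `Q_k(U₀)` ON MATRIX-VALUED FINE FIELDS**: the Fréchet derivative at `V₀` (= `↑U₀`) of 35b's matrix extension `iterM k` of the `k`-fold averaging `U ↦ Ū^k`,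
a continuous real-linear map from level-`0` to level-`k` matrix fields.  TOTAL (`fderiv` junk off the differentiability locus; under 35b's guard `SmallBelow … k U₀` it is THE
derivative, `hasFDerivAt_iterM`). [cite: Balaban1985Variational, (44) p.285; Balaban1985BackgroundPropagators, (3.13)-(3.16) p.393; Balaban1987RG1, (0.21) p.256] -/
def dIterL (k : ℕ) (V₀ : PBond P 0 → Matrix (Fin N) (Fin N) ℂ) :
    (PBond P 0 → Matrix (Fin N) (Fin N) ℂ) →L[ℝ] (PBond P k → Matrix (Fin N) (Fin N) ℂ) :=
  fderiv ℝ (iterM k : (PBond P 0 → Matrix (Fin N) (Fin N) ℂ) → PBond P k → Matrix (Fin N) (Fin N) ℂ) V₀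

/-- `Q_0 = id`. [cite: Balaban1987RG1, (0.21) p.256 (bookkeeping)] -/
@[simp] theorem dIterL_zero (V₀ : PBond P 0 → Matrix (Fin N) (Fin N) ℂ) :
    dIterL 0 V₀ = ContinuousLinearMap.id ℝ (PBond P 0 → Matrix (Fin N) (Fin N) ℂ) := by
  unfold dIterL
  have h : (iterM 0 : (PBond P 0 → Matrix (Fin N) (Fin N) ℂ) → PBond P 0 → Matrix (Fin N) (Fin N) ℂ) = id := funext fun V => rfl
  rw [h, fderiv_id]

/-- **CHAIN RULE ALONG THE LEVELS, general field**: if `iterM k` is differentiable at `V₀` and the loop matrices of `iterM k V₀` lie in the polydisc, then `iterM (k+1)` has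
derivative `dAvgL (iterM k V₀) ∘ dIterL k V₀` at `V₀`. [cite: Balaban1987RG1, (0.21) p.256; Balaban1985Variational, (44) p.285] -/
theorem hasFDerivAt_iterM_succ_of {k : ℕ} {V₀ : PBond P 0 → Matrix (Fin N) (Fin N) ℂ}
    (hk : DifferentiableAt ℝ (iterM k : (PBond P 0 → Matrix (Fin N) (Fin N) ℂ) → PBond P k → Matrix (Fin N) (Fin N) ℂ) V₀)
    (ha : ∀ (c : PBond P (k + 1)) (i : Idx P), ‖loopM (iterM k V₀) c i - 1‖ < 1) :
    HasFDerivAt (iterM (k + 1) : (PBond P 0 → Matrix (Fin N) (Fin N) ℂ) → PBond P (k + 1) → Matrix (Fin N) (Fin N) ℂ)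
      ((dAvgL (iterM k V₀)).comp (dIterL k V₀)) V₀ :=
  (hasFDerivAt_avgM ha).comp V₀ hk.hasFDerivAt

/-- The same as an identity of operators: `Q_{k+1}(V₀) = dAvgL(iterM k V₀) ∘ Q_k(V₀)`. [cite: Balaban1987RG1, (0.21) p.256; Balaban1985Variational, (44) p.285] -/
theorem dIterL_succ_of {k : ℕ} {V₀ : PBond P 0 → Matrix (Fin N) (Fin N) ℂ}
    (hk : DifferentiableAt ℝ (iterM k : (PBond P 0 → Matrix (Fin N) (Fin N) ℂ) → PBond P k → Matrix (Fin N) (Fin N) ℂ) V₀)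
    (ha : ∀ (c : PBond P (k + 1)) (i : Idx P), ‖loopM (iterM k V₀) c i - 1‖ < 1) :
    dIterL (k + 1) V₀ = (dAvgL (iterM k V₀)).comp (dIterL k V₀) :=
  (hasFDerivAt_iterM_succ_of hk ha).fderiv

variable [NeZero N]

/-- ★ **UNDER 35b's GUARD BELOW `k`, `iterM k` HAS DERIVATIVE `Q_k(↑U)` AT `↑U`** (`contDiffAt_iterM`). [cite: Balaban1985Variational, (44) p.285; Balaban1987RG1, (0.4) p.253, (0.21) p.256] -/
theorem hasFDerivAt_iterM {U : GaugeField P 0 (SU N)} (k : ℕ) (h : SmallBelow (fun j => blockAvg (P := P) (j := j) expMeanLogSU) k U) :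
    HasFDerivAt (iterM k : (PBond P 0 → Matrix (Fin N) (Fin N) ℂ) → PBond P k → Matrix (Fin N) (Fin N) ℂ) (dIterL k (coeField U)) (coeField U) :=
  ((contDiffAt_iterM k h).differentiableAt (by simp)).hasFDerivAt

/-- Under the guard below `k+1` the loop matrices of `iterM k ↑U = ↑Ū^k` lie in the polydisc. [cite: Balaban1987RG1, (0.4) p.253 (bookkeeping)] -/
theorem loopM_iterM_mem_polydisc {U : GaugeField P 0 (SU N)} {k : ℕ} (h : SmallBelow (fun j => blockAvg (P := P) (j := j) expMeanLogSU) (k + 1) U)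
    (c : PBond P (k + 1)) (i : Idx P) : ‖loopM (iterM k (coeField U)) c i - 1‖ < 1 := by
  rw [← coeField_iter_eq_iterM k (h.mono (Nat.le_succ k))]
  exact norm_loopM_coeField_sub_one_lt_one _ c (h k (Nat.lt_succ_self k) c) i

/-- ★ **THE CHAIN RULE UNDER THE GUARD**: `Q_{k+1}(↑U) = dAvgL(↑Ū^k(U)) ∘ Q_k(↑U)` whenever `SmallBelow … (k+1) U`. [cite: Balaban1985Variational, (44) p.285; Balaban1987RG1, (0.21) p.256] -/
theorem dIterL_succ {U : GaugeField P 0 (SU N)} {k : ℕ} (h : SmallBelow (fun j => blockAvg (P := P) (j := j) expMeanLogSU) (k + 1) U) :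
    dIterL (k + 1) (coeField U) = (dAvgL (iterM k (coeField U))).comp (dIterL k (coeField U)) :=
  dIterL_succ_of ((contDiffAt_iterM k (h.mono (Nat.le_succ k))).differentiableAt (by simp)) (loopM_iterM_mem_polydisc h)

/-- ★ **CURVE FORM FOR THE TRUE AVERAGING**: along a family `Γ` of `SU(N)` configurations with matrix velocity `Y` at `0` and the guard below `k` eventually along `Γ`,
`t ↦ ↑Ū^k(Γ t)` has derivative `Q_k(↑Γ 0) Y` at `0` (35b's agreement `coeField_iter_eq_iterM` near `0`). [cite: Balaban1985Variational, (44) p.285; Balaban1987RG1, (0.4) p.253, (0.21) p.256] -/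
theorem hasDerivAt_coeField_iter_of_eventually {k : ℕ} {Γ : ℝ → GaugeField P 0 (SU N)} {Y : PBond P 0 → Matrix (Fin N) (Fin N) ℂ}
    (hΓ : HasDerivAt (fun t => coeField (Γ t)) Y 0)
    (hev : ∀ᶠ t in 𝓝 (0 : ℝ), SmallBelow (fun j => blockAvg (P := P) (j := j) expMeanLogSU) k (Γ t)) :
    HasDerivAt (fun t => coeField (Averaging.iter (fun j => blockAvg (P := P) (j := j) expMeanLogSU) k (Γ t))) (dIterL k (coeField (Γ 0)) Y) 0 := by
  have h0 : SmallBelow (fun j => blockAvg (P := P) (j := j) expMeanLogSU) k (Γ 0) := hev.self_of_nhds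
  have hcomp := (hasFDerivAt_iterM k h0).comp_hasDerivAt (0 : ℝ) hΓ
  exact hcomp.congr_of_eventuallyEq (hev.mono fun t ht => coeField_iter_eq_iterM k ht)

/-- ★★ **THE VELOCITY OF `Ū^k` ALONG 35a's EXPONENTIAL CHART**: under `SmallBelow … k U`, `t ↦ ↑Ū^k(U·exp(tX))` has derivative `Q_k(↑U)[b ↦ U_b·X_b]` at `0`
(the guard is open along the chart: n07-w2's `eventually_smallBelow_expChart`). [cite: Balaban1985Variational, (3) p.278, (44) p.285; Balaban1987RG1, (0.4) p.253, (0.21) p.256] -/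
theorem hasDerivAt_coeField_iter_expChart_smul {U : GaugeField P 0 (SU N)} {k : ℕ}
    (h : SmallBelow (fun j => blockAvg (P := P) (j := j) expMeanLogSU) k U) (X : PBond P 0 → lieSU (Fin N)) :
    HasDerivAt (fun t : ℝ => coeField (Averaging.iter (fun j => blockAvg (P := P) (j := j) expMeanLogSU) k (expChart U (t • X))))
      (dIterL k (coeField U) (fun b => (U b : Matrix (Fin N) (Fin N) ℂ) * (X b : Matrix (Fin N) (Fin N) ℂ))) 0 := by
  have hΓ : HasDerivAt (fun t : ℝ => coeField (expChart U (t • X)))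
      (fun b => (U b : Matrix (Fin N) (Fin N) ℂ) * (X b : Matrix (Fin N) (Fin N) ℂ)) 0 :=
    hasDerivAt_pi.2 fun b => hasDerivAt_coe_expChart_along (U := U) (c := fun t : ℝ => t • X) (hasDerivAt_ray X) (zero_smul ℝ X) b
  have ht : Tendsto (fun t : ℝ => t • X) (𝓝 0) (𝓝 0) := by
    have hc : Continuous fun t : ℝ => t • X := continuous_id.smul continuous_const
    simpa only [zero_smul] using hc.tendsto 0
  have hev : ∀ᶠ t in 𝓝 (0 : ℝ), SmallBelow (fun j => blockAvg (P := P) (j := j) expMeanLogSU) k (expChart U (t • X)) :=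
    ht.eventually (eventually_smallBelow_expChart h)
  have hD := hasDerivAt_coeField_iter_of_eventually (Γ := fun t : ℝ => expChart U (t • X)) hΓ hev
  simp only [zero_smul, expChart_zero] at hD
  exact hD

/-- The same bond-wise: `d∕dt ↑(Ū^k(U·exp(tX)) c)|₀ = (Q_k(↑U)[b ↦ U_b·X_b])(c)` — the velocity currency of 35c∕35e and of n07-w2's chart derivative.
[cite: Balaban1985Variational, (3) p.278, (44) p.285; Balaban1987RG1, (0.21) p.256] -/
theorem hasDerivAt_coe_iter_expChart_smul {U : GaugeField P 0 (SU N)} {k : ℕ}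
    (h : SmallBelow (fun j => blockAvg (P := P) (j := j) expMeanLogSU) k U) (X : PBond P 0 → lieSU (Fin N)) (c : PBond P k) :
    HasDerivAt (fun t : ℝ => ((Averaging.iter (fun j => blockAvg (P := P) (j := j) expMeanLogSU) k (expChart U (t • X)) c : SU N) :
        Matrix (Fin N) (Fin N) ℂ))
      (dIterL k (coeField U) (fun b => (U b : Matrix (Fin N) (Fin N) ℂ) * (X b : Matrix (Fin N) (Fin N) ℂ)) c) 0 :=
  (hasDerivAt_pi.1 (hasDerivAt_coeField_iter_expChart_smul h X)) c

end Iterate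

/-! ## §4  Print's `Q_k(U₀)X` on Lie-algebra fields: the left-trivialised reading `qLin` -/

section SUReading

variable {P : Params} {N : ℕ}

/-- **PRINT'S `Q_k(U₀)X` IN THE LEFT-TRIVIALISED READING**: for a Lie-algebra field `X : bonds → 𝔰𝔲(N)`, `(qLin k U₀ X)(c) = (iterM k ↑U₀ c)⋆ · (Q_k(↑U₀)[b ↦ U₀,b·X_b])(c)` —
the velocity of `t ↦ Ū^k(U₀·exp(tX))(c)` pulled back to the identity by `Ū^k(U₀)(c)⁻¹ = Ū^k(U₀)(c)⋆` (under the guard `iterM k ↑U₀ = ↑Ū^k(U₀)`).  TOTAL, `M_N(ℂ)`-valued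
(its `𝔰𝔲(N)`-membership under the guard is the sequel's). [cite: Balaban1985Variational, (3)-(4) p.278, (44) p.285; Balaban1985BackgroundPropagators, (3.13) p.393] -/
def qLin (k : ℕ) (U₀ : GaugeField P 0 (SU N)) (X : PBond P 0 → lieSU (Fin N)) : PBond P k → Matrix (Fin N) (Fin N) ℂ :=
  fun c => star (iterM k (coeField U₀) c) *
    dIterL k (coeField U₀) (fun b => (U₀ b : Matrix (Fin N) (Fin N) ℂ) * (X b : Matrix (Fin N) (Fin N) ℂ)) c

/-- Unfolding of `qLin`. [cite: Balaban1985Variational, (44) p.285 (bookkeeping)] -/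
theorem qLin_apply (k : ℕ) (U₀ : GaugeField P 0 (SU N)) (X : PBond P 0 → lieSU (Fin N)) (c : PBond P k) :
    qLin k U₀ X c = star (iterM k (coeField U₀) c) *
      dIterL k (coeField U₀) (fun b => (U₀ b : Matrix (Fin N) (Fin N) ℂ) * (X b : Matrix (Fin N) (Fin N) ℂ)) c := rfl

/-- The chart velocity field `b ↦ U₀,b·X_b` is additive in `X`. [cite: Balaban1985Variational, (3) p.278 (bookkeeping)] -/
theorem velField_add (U₀ : GaugeField P 0 (SU N)) (X X' : PBond P 0 → lieSU (Fin N)) :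
    (fun b => (U₀ b : Matrix (Fin N) (Fin N) ℂ) * ((X + X') b : Matrix (Fin N) (Fin N) ℂ)) =
      (fun b => (U₀ b : Matrix (Fin N) (Fin N) ℂ) * (X b : Matrix (Fin N) (Fin N) ℂ)) +
        fun b => (U₀ b : Matrix (Fin N) (Fin N) ℂ) * (X' b : Matrix (Fin N) (Fin N) ℂ) := by
  funext b
  simp only [Pi.add_apply, Submodule.coe_add, mul_add]

/-- The chart velocity field is real-homogeneous in `X`. [cite: Balaban1985Variational, (3) p.278 (bookkeeping)] -/
theorem velField_smul (U₀ : GaugeField P 0 (SU N)) (a : ℝ) (X : PBond P 0 → lieSU (Fin N)) :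
    (fun b => (U₀ b : Matrix (Fin N) (Fin N) ℂ) * ((a • X) b : Matrix (Fin N) (Fin N) ℂ)) =
      a • fun b => (U₀ b : Matrix (Fin N) (Fin N) ℂ) * (X b : Matrix (Fin N) (Fin N) ℂ) := by
  funext b
  simp only [Pi.smul_apply, Submodule.coe_smul, mul_smul_comm]

/-- **LINEARITY**: `Q_k(U₀)(X + X′) = Q_k(U₀)X + Q_k(U₀)X′`. [cite: Balaban1985Variational, (44) p.285] -/
theorem qLin_add (k : ℕ) (U₀ : GaugeField P 0 (SU N)) (X X' : PBond P 0 → lieSU (Fin N)) :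
    qLin k U₀ (X + X') = qLin k U₀ X + qLin k U₀ X' := by
  funext c
  rw [Pi.add_apply, qLin_apply, qLin_apply, qLin_apply, velField_add, map_add, Pi.add_apply, mul_add]

/-- **LINEARITY**: `Q_k(U₀)(aX) = a·Q_k(U₀)X` (`a ∈ ℝ`). [cite: Balaban1985Variational, (44) p.285] -/
theorem qLin_smul (k : ℕ) (U₀ : GaugeField P 0 (SU N)) (a : ℝ) (X : PBond P 0 → lieSU (Fin N)) :
    qLin k U₀ (a • X) = a • qLin k U₀ X := by
  funext c
  rw [Pi.smul_apply, qLin_apply, qLin_apply, velField_smul, map_smul, Pi.smul_apply, mul_smul_comm]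

/-- `Q_k(U₀)0 = 0`. [cite: Balaban1985Variational, (44) p.285 (bookkeeping)] -/
@[simp] theorem qLin_zero (k : ℕ) (U₀ : GaugeField P 0 (SU N)) : qLin k U₀ 0 = 0 := by
  have h := qLin_smul k U₀ 0 0
  rwa [zero_smul, zero_smul] at h

variable [NeZero N]

/-- **READ BACK**: under the guard, `↑Ū^k(U₀)(c) · (qLin k U₀ X)(c)` is the chart velocity at `c` (the left factor is the unitary `↑Ū^k(U₀)(c)⋆`). [cite: Balaban1985Variational, (3)-(4) p.278, (44) p.285] -/
theorem coe_iter_mul_qLin {U₀ : GaugeField P 0 (SU N)} {k : ℕ} (h : SmallBelow (fun j => blockAvg (P := P) (j := j) expMeanLogSU) k U₀)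
    (X : PBond P 0 → lieSU (Fin N)) (c : PBond P k) :
    ((Averaging.iter (fun j => blockAvg (P := P) (j := j) expMeanLogSU) k U₀ c : SU N) : Matrix (Fin N) (Fin N) ℂ) * qLin k U₀ X c =
      dIterL k (coeField U₀) (fun b => (U₀ b : Matrix (Fin N) (Fin N) ℂ) * (X b : Matrix (Fin N) (Fin N) ℂ)) c := by
  rw [qLin_apply, ← coeField_iter_eq_iterM k h, coeField_apply, ← mul_assoc,
    Unitary.mul_star_self_of_mem (Matrix.specialUnitaryGroup_le_unitaryGroup (Averaging.iter _ k U₀ c).2), one_mul]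

/-- ★ **KERNEL CURRENCY**: under the guard, `(qLin k U₀ X)(c) = 0` iff the chart velocity `(Q_k(↑U₀)[b ↦ U₀,b·X_b])(c)` vanishes — the form in which 35c∕35e and
n07-w2's `msChart` phrase kernel directions of the linearised constraint. [cite: Balaban1985Variational, (44)-(45) p.285, (82) p.290] -/
theorem qLin_eq_zero_iff {U₀ : GaugeField P 0 (SU N)} {k : ℕ} (h : SmallBelow (fun j => blockAvg (P := P) (j := j) expMeanLogSU) k U₀)
    (X : PBond P 0 → lieSU (Fin N)) (c : PBond P k) :
    qLin k U₀ X c = 0 ↔ dIterL k (coeField U₀) (fun b => (U₀ b : Matrix (Fin N) (Fin N) ℂ) * (X b : Matrix (Fin N) (Fin N) ℂ)) c = 0 := by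
  constructor
  · intro h0
    rw [← coe_iter_mul_qLin h X c, h0, mul_zero]
  · intro h0
    rw [qLin_apply, h0, mul_zero]

/-- ★★ **KERNEL OF `Q_k(U₀)` = DIRECTIONS OF VANISHING CHART VELOCITY**: under the guard below `k`, `qLin k U₀ X = 0` iff `d∕dt ↑(Ū^k(U₀·exp(tX)) c)|₀ = 0` at every
level-`k` bond — literally the hypothesis under which 35c∕35e quantify «kernel directions of the linearised `k`-fold averaging» (print's `Q_k(U₀)X = 0` of (82)–(83)).
[cite: Balaban1985Variational, (44)-(45) p.285, (82)-(83) p.290] -/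
theorem qLin_eq_zero_iff_hasDerivAt_zero {U₀ : GaugeField P 0 (SU N)} {k : ℕ} (h : SmallBelow (fun j => blockAvg (P := P) (j := j) expMeanLogSU) k U₀)
    (X : PBond P 0 → lieSU (Fin N)) :
    qLin k U₀ X = 0 ↔ ∀ c : PBond P k, HasDerivAt (fun t : ℝ =>
      ((Averaging.iter (fun j => blockAvg (P := P) (j := j) expMeanLogSU) k (expChart U₀ (t • X)) c : SU N) : Matrix (Fin N) (Fin N) ℂ)) 0 0 := by
  constructor
  · intro h0 c
    have hv := hasDerivAt_coe_iter_expChart_smul h X c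
    rwa [(qLin_eq_zero_iff h X c).1 (by rw [h0]; rfl)] at hv
  · intro hX
    funext c
    exact (qLin_eq_zero_iff h X c).2 ((hasDerivAt_coe_iter_expChart_smul h X c).unique (hX c))

end SUReading

/-! ## §5  At NODE 00's objects (`avOfRecord F N K j = blockAvg expMeanLogSU`, `rfl`) -/

section Record

variable {F : T4Family} {N : ℕ} [NeZero N]

/-- At NODE 00's objects: under `SmallBelow (avOfRecord F N K) k U`, `iterM k` has derivative `Q_k(↑U)` at `↑U`. [cite: Balaban1985Variational, (44) p.285; Balaban1988Convergent, (2.11) p.256] -/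
theorem hasFDerivAt_iterM_avOfRecord {K k : ℕ} {U : GaugeField (F.P K) 0 (SU N)} (h : SmallBelow (avOfRecord F N K) k U) :
    HasFDerivAt (iterM k : (PBond (F.P K) 0 → Matrix (Fin N) (Fin N) ℂ) → PBond (F.P K) k → Matrix (Fin N) (Fin N) ℂ) (dIterL k (coeField U))
      (coeField U) :=
  hasFDerivAt_iterM k h

/-- At NODE 00's objects: the chain rule `Q_{k+1}(↑U) = dAvgL(↑Ū^k(U)) ∘ Q_k(↑U)` under the guard below `k+1`. [cite: Balaban1985Variational, (44) p.285; Balaban1987RG1, (0.21) p.256] -/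
theorem dIterL_succ_avOfRecord {K k : ℕ} {U : GaugeField (F.P K) 0 (SU N)} (h : SmallBelow (avOfRecord F N K) (k + 1) U) :
    dIterL (k + 1) (coeField U) = (dAvgL (iterM k (coeField U))).comp (dIterL k (coeField U)) :=
  dIterL_succ h

/-- At NODE 00's objects: the curve form for `avgFamily (avOfRecord F N K)`. [cite: Balaban1985Variational, (44) p.285; Balaban1988Convergent, (2.11) p.256] -/
theorem hasDerivAt_coeField_avgFamily_of_eventually {K k : ℕ} {Γ : ℝ → GaugeField (F.P K) 0 (SU N)} {Y : PBond (F.P K) 0 → Matrix (Fin N) (Fin N) ℂ}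
    (hΓ : HasDerivAt (fun t => coeField (Γ t)) Y 0) (hev : ∀ᶠ t in 𝓝 (0 : ℝ), SmallBelow (avOfRecord F N K) k (Γ t)) :
    HasDerivAt (fun t => coeField (avgFamily (avOfRecord F N K) (Γ t) k)) (dIterL k (coeField (Γ 0)) Y) 0 :=
  hasDerivAt_coeField_iter_of_eventually hΓ hev

end Record

end Literature.MathematicalPhysics.QuantumFieldTheory.Balaban1983to89.Node00

end
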